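import Summits.QuantumFields.YangMills.Theorems.ColdStartUniversalityLatticeLangevinHypercontractivityDini
import Summits.QuantumFields.YangMills.Theorems.ColdStartUniversalityLqFlowConverseTools
import Summits.QuantumFields.YangMills.Theorems.ColdStartUniversalityLatticeLangevinGeneratorSymmetric
import Summits.QuantumFields.YangMills.Theorems.ColdStartUniversalityLatticeLangevinWilsonSemigroupConvexity
import HarnessLib

/-!
# Route `ColdStartUniversality` (fixed-cut-off package, `Lᵖ` side): the CONVERSE of Gross's theorem for the SZZ semigroup —
# HYPERCONTRACTIVITY `‖κ_t F‖_{1+e^{4ρt}} ≤ ‖F‖₂` ⇒ the generator-form LOG-SOBOLEV inequality `ρ·Ent_μ(F²) ≤ −∫ F·𝓛f dμ`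

Helper file (seat `ym-line-csu-p1`, g36; `--supports stmt-QuantumFields-24809`), companion of `…LatticeLangevinHypercontractivity`
(LSI ⇒ hypercontractivity).  SU(2) lattice Langevin dynamics of Shen–Zhu–Zhu at `(L, β')`, Wilson measure `μ = μ_{β'}`, ANY realising
kernel family `κ`.  Together the two files give GROSS'S EQUIVALENCE «log-Sobolev constant = hypercontractivity constant» (Diaconis–
Saloff-Coste Thm 3.5 (i)+(ii)) for this diffusion, kernel-checked, on positive `C³` compactly supported cylinders:

* (real-variable steps `LqFlow.integral_rpow_add_ge`, `LqFlow.gross_converse_step` in the prequel `…LqFlowConverseTools`);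
* ★★★ `generatorLogSobolev_of_hypercontractive` — if `(∫ (κ_tF)^{1+e^{4ρt}} dμ)^{1/(1+e^{4ρt})} ≤ (∫ F² dμ)^{1/2}` for every positive `C³`
  compactly supported cylinder `F` and every `t ≥ 0` (`ρ ≥ 0`), then every such `F = f∘coords` satisfies
  `ρ·(∫ F² log F² dμ − ∫F² dμ · log ∫F² dμ) ≤ −∫ F·𝓛f dμ` — the generator-form log-Sobolev inequality with THE SAME constant
  (`𝓔_{2h}(F) → −∫F𝓛f`, `tendsto_dirichletForm_semigroup`).

THEOREMS ONLY, no definition, no sorry.  HONEST FRAMING: RECORD-rung R3 plumbing at FIXED cut-off; an equivalence of two functional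
inequalities for the fixed-cut-off dynamics, with no cut-off-uniform content; no crux, rung or summit statement is proved; the Yang–Mills
mass gap is NOT proved.
-/

set_option autoImplicit false

noncomputable section

namespace Summit.QuantumFields.YangMills.Theorems.ColdStartUniversality

open MeasureTheory ProbabilityTheory Filter Set Topology
open scoped BigOperators NNReal ENNReal
open Literature.Probability.Process Literature.MathematicalPhysics.QuantumFieldTheory
open Literature.MathematicalPhysics.QuantumLattice (fundamentalRep fundamentalLatticeRep continuous_fundamentalRep)


variable {L : ℕ} [NeZero L]

/-! ## Hypercontractivity ⇒ log-Sobolev -/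

/-- ★★★ **The converse of Gross's theorem for the SZZ semigroup.**  Let `ρ ≥ 0` and suppose the realising kernel family `κ` is
HYPERCONTRACTIVE with exponent curve `q(t) = 1 + e^{4ρt}` on positive smooth cylinders:
`(∫ (κ_t G)^{q(t)} dμ_{β'})^{1/q(t)} ≤ (∫ G² dμ_{β'})^{1/2}` for every `C³` compactly supported `g` with `G = g∘coords > 0` and every
`t ≥ 0`.  Then every such `F = f∘coords` satisfies the generator-form LOG-SOBOLEV inequality with the same constant,

  `ρ·(∫ F² log F² dμ_{β'} − ∫ F² dμ_{β'} · log ∫ F² dμ_{β'}) ≤ −∫ F·𝓛f dμ_{β'}`.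

One lattice step: `‖κ_hF‖_{2+ε} ≤ ‖F‖₂` (`ε = e^{4ρh} − 1`), `∫ (κ_hF)^{2+ε} ≥ ∫(κ_hF)² + ε∫(κ_hF)² log κ_hF − O(ε²)`,
`∫ (κ_hF)² = ∫ F κ_{2h}F = ‖F‖₂² − 2h·𝓔_{2h}(F)` (reversibility), `|∫(κ_hF)² log κ_hF − ∫ F² log F| = O(h)` give
`ρ·Ent(F²) ≤ 𝓔_{2h}(F) + O(h)` (`LqFlow.gross_converse_step`), and `𝓔_{2h}(F) → −∫ F·𝓛f` (`tendsto_dirichletForm_semigroup`).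
[cite: DiaconisSaloffcoste1996, Theorem 3.5 (i)] -/
theorem generatorLogSobolev_of_hypercontractive (L : ℕ) [NeZero L] (β' : ℝ)
    (κ : ℝ≥0 → Kernel (GaugeConfig 3 L (Matrix.specialUnitaryGroup (Fin 2) ℂ))
      (GaugeConfig 3 L (Matrix.specialUnitaryGroup (Fin 2) ℂ))) [∀ t, IsMarkovKernel (κ t)]
    (hreal : ∀ (t : ℝ≥0) (x : GaugeConfig 3 L (Matrix.specialUnitaryGroup (Fin 2) ℂ))
        (Ω : Type) [MeasurableSpace Ω] (P : Measure Ω) [IsProbabilityMeasure P]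
        (W : ℝ≥0 → Ω → (Edge 3 L × NoiseIdx 2 → ℝ)) (hW : IsFlatBrownian W P)
        (U : ℝ≥0 → Ω → GaugeConfig 3 L (Matrix.specialUnitaryGroup (Fin 2) ℂ)),
        (∀ ω, U 0 ω = x) →
        (latticeLangevinDynamics (fundamentalLatticeRep 2) β').IsSolution (fundamentalRep (Fin 2))
          hW.natFiltration P W U →
        κ t x = P.map (U t))
    {ρ : ℝ} (hρ : 0 ≤ ρ)
    (hHC : ∀ (g : (Edge 3 L × Fin 2 × Fin 2 × Bool → ℝ) → ℝ), ContDiff ℝ 3 g → HasCompactSupport g →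
      (∀ x : GaugeConfig 3 L (Matrix.specialUnitaryGroup (Fin 2) ℂ),
        0 < g (fun q => (fun z : ℂ => if q.2.2.2 then z.im else z.re)
          ((fundamentalRep (Fin 2) (x q.1) : Matrix (Fin 2) (Fin 2) ℂ) q.2.1 q.2.2.1))) →
      ∀ t : ℝ≥0,
        (∫ x, (∫ y, g (fun q => (fun z : ℂ => if q.2.2.2 then z.im else z.re)
            ((fundamentalRep (Fin 2) (y q.1) : Matrix (Fin 2) (Fin 2) ℂ) q.2.1 q.2.2.1)) ∂(κ t x)) ^ (1 + Real.exp (4 * ρ * t))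
            ∂(wilsonMeasure (d := 3) (L := L) (fundamentalRep (Fin 2)) β')) ^ (1 / (1 + Real.exp (4 * ρ * t))) ≤
          (∫ x, g (fun q => (fun z : ℂ => if q.2.2.2 then z.im else z.re)
            ((fundamentalRep (Fin 2) (x q.1) : Matrix (Fin 2) (Fin 2) ℂ) q.2.1 q.2.2.1)) ^ (2 : ℝ)
            ∂(wilsonMeasure (d := 3) (L := L) (fundamentalRep (Fin 2)) β')) ^ (1 / (2 : ℝ)))
    {f : (Edge 3 L × Fin 2 × Fin 2 × Bool → ℝ) → ℝ} (hf : ContDiff ℝ 3 f) (hfc : HasCompactSupport f)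
    (hpos : ∀ x : GaugeConfig 3 L (Matrix.specialUnitaryGroup (Fin 2) ℂ),
      0 < f (fun q => (fun z : ℂ => if q.2.2.2 then z.im else z.re)
        ((fundamentalRep (Fin 2) (x q.1) : Matrix (Fin 2) (Fin 2) ℂ) q.2.1 q.2.2.1))) :
    let coords : GaugeConfig 3 L (Matrix.specialUnitaryGroup (Fin 2) ℂ) → (Edge 3 L × Fin 2 × Fin 2 × Bool → ℝ) :=
      fun V q => (fun z : ℂ => if q.2.2.2 then z.im else z.re)
        ((fundamentalRep (Fin 2) (V q.1) : Matrix (Fin 2) (Fin 2) ℂ) q.2.1 q.2.2.1)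
    let gen : GaugeConfig 3 L (Matrix.specialUnitaryGroup (Fin 2) ℂ) → ℝ := fun V =>
      (∑ i : Edge 3 L × Fin 2 × Fin 2 × Bool, fderiv ℝ f (coords V) (Pi.single i 1) *
          (fun z : ℂ => if i.2.2.2 then z.im else z.re)
            ((latticeLangevinDynamics (fundamentalLatticeRep 2) β').drift
              (matrixConfig (fundamentalRep (Fin 2)) V) i.1 i.2.1 i.2.2.1) +
      1 / 2 * ∑ i : Edge 3 L × Fin 2 × Fin 2 × Bool, ∑ j : Edge 3 L × Fin 2 × Fin 2 × Bool,
        fderiv ℝ (fun z => fderiv ℝ f z (Pi.single i 1)) (coords V) (Pi.single j 1) *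
          ∑ n : Edge 3 L × NoiseIdx 2,
            (if n.1 = i.1 then (fun z : ℂ => if i.2.2.2 then z.im else z.re)
              ((latticeLangevinDynamics (fundamentalLatticeRep 2) β').noise
                (matrixConfig (fundamentalRep (Fin 2)) V) i.1 n.2 i.2.1 i.2.2.1) else 0) *
            (if n.1 = j.1 then (fun z : ℂ => if j.2.2.2 then z.im else z.re)
              ((latticeLangevinDynamics (fundamentalLatticeRep 2) β').noise
                (matrixConfig (fundamentalRep (Fin 2)) V) j.1 n.2 j.2.1 j.2.2.1) else 0))
    ρ * ((∫ V, f (coords V) ^ 2 * Real.log (f (coords V) ^ 2) ∂(wilsonMeasure (d := 3) (L := L) (fundamentalRep (Fin 2)) β')) -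
        (∫ V, f (coords V) ^ 2 ∂(wilsonMeasure (d := 3) (L := L) (fundamentalRep (Fin 2)) β')) *
          Real.log (∫ V, f (coords V) ^ 2 ∂(wilsonMeasure (d := 3) (L := L) (fundamentalRep (Fin 2)) β'))) ≤
      -∫ V, f (coords V) * gen V ∂(wilsonMeasure (d := 3) (L := L) (fundamentalRep (Fin 2)) β') := by
  intro coords gen
  classical
  haveI := secondCountableTopology_su2
  haveI := borelSpace_config L
  set μ : Measure (GaugeConfig 3 L (Matrix.specialUnitaryGroup (Fin 2) ℂ)) :=
    wilsonMeasure (d := 3) (L := L) (fundamentalRep (Fin 2)) β' with hμ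
  haveI : IsProbabilityMeasure μ :=
    isProbabilityMeasure_wilsonMeasure (d := 3) (L := L) (fundamentalRep (Fin 2)) (continuous_fundamentalRep (Fin 2)) β'
  set F : GaugeConfig 3 L (Matrix.specialUnitaryGroup (Fin 2) ℂ) → ℝ := fun x => f (coords x) with hF
  have hFc : Continuous F := hf.continuous.comp (continuous_coords (L := L))
  have hFpos : ∀ x, 0 < F x := hpos
  obtain ⟨δ, hδ, hδF⟩ := exists_pos_le_of_continuous_of_compactSpace hFc hFpos
  obtain ⟨B, -, hBabs⟩ := exists_abs_le_of_continuous hFc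
  have hFB : ∀ x, F x ≤ B := fun x => (le_abs_self _).trans (hBabs x)
  have hδB : δ ≤ B := (hδF (Classical.arbitrary _)).trans (hFB _)
  have hB0 : 0 < B := lt_of_lt_of_le hδ hδB
  obtain ⟨C, hC0, hLipF⟩ := exists_abs_transition_cylinder_sub_le L β' κ hreal hf hfc
  have hκ0 : κ 0 = Kernel.id := transitionKernel_zero_eq_id L β' κ hreal
  -- `N = ∫ F²`, `Lg = log N`, `X = ∫ F² log F`, `Ent = 2X − N·Lg ≥ 0`
  set N : ℝ := ∫ x, F x ^ 2 ∂μ with hN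
  have hF2c : Continuous fun x => F x ^ 2 := hFc.pow 2
  have hNpos : 0 < N := by
    have h1 : δ ^ 2 ≤ N := by
      have := integral_mono (integrable_const (δ ^ 2)) (integrable_of_continuous_of_compactSpace hF2c μ)
        fun x => pow_le_pow_left₀ hδ.le (hδF x) 2
      rwa [integral_const, probReal_univ, one_smul] at this
    exact lt_of_lt_of_le (by positivity) h1
  set Lg : ℝ := Real.log N with hLg
  set X : ℝ := ∫ x, F x ^ (2 : ℝ) * Real.log (F x) ∂μ with hX
  set Ent : ℝ := (∫ x, F x ^ 2 * Real.log (F x ^ 2) ∂μ) - N * Lg with hEnt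
  have hEnt2 : Ent = 2 * X - N * Lg := by
    have e : ∫ x, F x ^ 2 * Real.log (F x ^ 2) ∂μ = 2 * X := by
      rw [hX, ← integral_const_mul]
      refine integral_congr_ae (Eventually.of_forall fun x => ?_)
      show F x ^ 2 * Real.log (F x ^ 2) = 2 * (F x ^ (2 : ℝ) * Real.log (F x))
      rw [Real.log_pow, Real.rpow_two]; push_cast; ring
    rw [hEnt, e]
  have hEnt0 : 0 ≤ Ent := by
    have h := entropy_nonneg μ (g := fun x => F x ^ 2) (fun x => sq_nonneg _)
      (integrable_of_continuous_of_compactSpace hF2c μ)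
      (integrable_of_continuous_of_compactSpace (hF2c.mul (hF2c.log fun x => (pow_pos (hFpos x) 2).ne')) μ)
    rw [hEnt, hLg, hN]; exact h
  -- `Λ`, `M₁` on `[δ, B]` (exponent `q = 2`)
  set Λ : ℝ := max |Real.log δ| |Real.log B| with hΛ
  have hΛ0 : 0 ≤ Λ := le_max_of_le_left (abs_nonneg _)
  have hΛI : ∀ ξ, δ ≤ ξ → ξ ≤ B → |Real.log ξ| ≤ Λ := by
    intro ξ h1 h2
    have hξ : 0 < ξ := lt_of_lt_of_le hδ h1
    have hl1 : Real.log δ ≤ Real.log ξ := Real.log_le_log hδ h1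
    have hl2 : Real.log ξ ≤ Real.log B := Real.log_le_log hξ h2
    rw [abs_le]
    constructor
    · have : |Real.log δ| ≤ Λ := le_max_left _ _
      linarith [neg_abs_le (Real.log δ)]
    · exact (hl2.trans (le_abs_self _)).trans (le_max_right _ _)
  obtain ⟨M₁, hM₁⟩ := (isCompact_Icc : IsCompact (Icc δ B)).exists_bound_of_continuousOn
    (f := fun ξ : ℝ => ξ ^ ((2 : ℝ) - 1) * (2 * Real.log ξ + 1))
    ((ContinuousOn.rpow_const continuousOn_id fun ξ hξ => Or.inl (lt_of_lt_of_le hδ hξ.1).ne').mul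
      (((continuousOn_id.log fun ξ hξ => (lt_of_lt_of_le hδ hξ.1).ne').const_smul (2 : ℝ) |>.congr
        (fun ξ _ => by simp [smul_eq_mul])).add continuousOn_const))
  have hM₁' : ∀ ξ, δ ≤ ξ → ξ ≤ B → |ξ ^ ((2 : ℝ) - 1) * (2 * Real.log ξ + 1)| ≤ M₁ := fun ξ h1 h2 => by
    simpa [Real.norm_eq_abs] using hM₁ ξ ⟨h1, h2⟩
  have hM₁0 : 0 ≤ M₁ := (norm_nonneg _).trans (hM₁ δ ⟨le_rfl, hδB⟩)
  -- constants and the scale-`τ` Dirichlet form `Φ(τ) = τ⁻¹(∫ F·F − ∫ F κ_τ F)`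
  set E₁ : ℝ := 4 * ρ * Real.exp (4 * ρ) with hE₁
  have hE₁0 : 0 ≤ E₁ := by rw [hE₁]; positivity
  set B₂ : ℝ := B ^ (2 : ℝ) with hB₂
  have hB₂0 : 0 ≤ B₂ := (Real.rpow_pos_of_pos hB0 _).le
  set R : ℝ := (E₁ * (M₁ * C) + E₁ ^ 2 * Λ ^ 2 * B₂ + N * E₁ ^ 2 * Lg ^ 2 / 4) / 2 with hR
  set Φ : ℝ → ℝ := fun τ => τ⁻¹ * ((∫ x, F x * F x ∂μ) - ∫ x, F x * (∫ y, F y ∂(κ τ.toNNReal x)) ∂μ) with hΦ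
  -- the limit `Φ(τ) → −∫ F·𝓛f`
  have hlimΦ : Tendsto Φ (𝓝[>] 0) (𝓝 (-∫ x, F x * gen x ∂μ)) := by
    have T := tendsto_dirichletForm_semigroup L β' κ hreal hf hfc
    have e : Φ = fun τ => -(τ⁻¹ * ((∫ x, F x * (∫ y, F y ∂(κ τ.toNNReal x)) ∂μ) - ∫ x, F x * F x ∂μ)) := by
      funext τ; simp only [hΦ]; ring
    rw [e]
    exact T.neg
  -- ONE STEP: for small `τ > 0`, `ρ·Ent ≤ Φ(τ) + R·(τ/2)`
  have hEL1 : 0 < E₁ * Λ + 1 := by have := mul_nonneg hE₁0 hΛ0; linarith only [this]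
  have hELg1 : 0 < E₁ * |Lg| + 1 := by have := mul_nonneg hE₁0 (abs_nonneg Lg); linarith only [this]
  set τ₀ : ℝ := 2 * min 1 (min (1 / (E₁ * Λ + 1)) (1 / (E₁ * |Lg| + 1))) with hτ₀
  have hτ₀pos : 0 < τ₀ := by
    rw [hτ₀]; exact mul_pos two_pos (lt_min one_pos (lt_min (by positivity) (by positivity)))
  have hstep : ∀ τ : ℝ, 0 < τ → τ < τ₀ → ρ * Ent ≤ Φ τ + R * (τ / 2) := by
    intro τ hτ hττ₀
    -- `h = τ/2`
    set hn : ℝ≥0 := (τ / 2).toNNReal with hhn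
    have hhR : ((hn : ℝ≥0) : ℝ) = τ / 2 := by rw [hhn, Real.coe_toNNReal _ (by linarith)]
    have hhpos : (0 : ℝ) < hn := by rw [hhR]; linarith
    have hmin : (hn : ℝ) < min 1 (min (1 / (E₁ * Λ + 1)) (1 / (E₁ * |Lg| + 1))) := by rw [hhR, hτ₀] at *; linarith
    have hh1 : (hn : ℝ) ≤ 1 := hmin.le.trans (min_le_left _ _)
    have hh2 : (hn : ℝ) ≤ 1 / (E₁ * Λ + 1) := hmin.le.trans ((min_le_right _ _).trans (min_le_left _ _))
    have hh3 : (hn : ℝ) ≤ 1 / (E₁ * |Lg| + 1) := hmin.le.trans ((min_le_right _ _).trans (min_le_right _ _))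
    have hτnn : τ.toNNReal = hn + hn := by
      rw [hhn, ← Real.toNNReal_add (by linarith) (by linarith)]; congr 1; ring
    -- `w = κ_h F`
    set w : GaugeConfig 3 L (Matrix.specialUnitaryGroup (Fin 2) ℂ) → ℝ := fun x => ∫ y, F y ∂(κ hn x) with hw
    have hwc : Continuous w := continuous_integral_transitionKernel L β' κ hreal hn hFc
    have hδw : ∀ x, δ ≤ w x := by
      intro x
      have := integral_mono (integrable_const (μ := κ hn x) δ) (integrable_of_continuous_of_compactSpace hFc _) fun y => hδF y
      rwa [integral_const, probReal_univ, one_smul] at this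
    have hwB : ∀ x, w x ≤ B := by
      intro x
      have := integral_mono (integrable_of_continuous_of_compactSpace hFc _) (integrable_const (μ := κ hn x) B) fun y => hFB y
      rwa [integral_const, probReal_univ, one_smul] at this
    have hwpos : ∀ x, 0 < w x := fun x => lt_of_lt_of_le hδ (hδw x)
    have hD : ∀ x, |w x - F x| ≤ C * hn := by
      intro x
      have h1 := hLipF 0 hn x
      rw [zero_add, hκ0, Kernel.id_apply, integral_dirac] at h1
      exact h1
    -- the exponent increment `ε = e^{4ρh} − 1`
    set ε : ℝ := Real.exp (4 * ρ * hn) - 1 with hε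
    obtain ⟨hεlo', hεhi', -⟩ := LqFlow.exponent_increment_bounds (q := 2) hρ (by norm_num) hhpos.le hh1
    have hεlo : 4 * ρ * hn ≤ ε := by rw [hε]; linarith only [hεlo']
    have hεhi : ε ≤ E₁ * hn := by rw [hε, hE₁]; linarith only [hεhi']
    have h4 : 0 ≤ 4 * ρ * (hn : ℝ) := by positivity
    have hε0 : 0 ≤ ε := h4.trans hεlo
    have hεΛ : ε * Λ ≤ 1 := by
      have h1 : ε * Λ ≤ E₁ * hn * Λ := mul_le_mul_of_nonneg_right hεhi hΛ0
      have h2 : (hn : ℝ) * (E₁ * Λ + 1) ≤ 1 := (le_div_iff₀ hEL1).1 hh2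
      have e : E₁ * (hn : ℝ) * Λ = hn * (E₁ * Λ) := by ring
      have e2 : (hn : ℝ) * (E₁ * Λ + 1) = hn * (E₁ * Λ) + hn := by ring
      rw [e] at h1
      linarith only [h1, h2, e2, hhpos]
    have hεL : |ε * Lg / 2| ≤ 1 := by
      have h1 : |ε * Lg / 2| = ε * |Lg| / 2 := by
        rw [abs_div, abs_mul, abs_of_nonneg hε0, abs_of_pos (by norm_num : (0:ℝ) < 2)]
      have h2 : (hn : ℝ) * (E₁ * |Lg| + 1) ≤ 1 := (le_div_iff₀ hELg1).1 hh3
      have h3 : ε * |Lg| ≤ E₁ * hn * |Lg| := mul_le_mul_of_nonneg_right hεhi (abs_nonneg _)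
      have e : E₁ * (hn : ℝ) * |Lg| = hn * (E₁ * |Lg|) := by ring
      have e2 : (hn : ℝ) * (E₁ * |Lg| + 1) = hn * (E₁ * |Lg|) + hn := by ring
      rw [e] at h3
      rw [h1]
      have : 0 ≤ ε * |Lg| := mul_nonneg hε0 (abs_nonneg _)
      linarith only [h2, h3, e2, hhpos, this]
    -- hypercontractivity at `t = h`: `A ≤ N·e^{εLg/2}`, `A = ∫ w^{2+ε}`
    have hA0 : 0 < ∫ x, w x ^ (2 + ε) ∂μ := by
      have hc : Continuous fun x => w x ^ (2 + ε) := hwc.rpow_const fun x => Or.inl (hwpos x).ne'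
      have h1 : δ ^ (2 + ε) ≤ ∫ x, w x ^ (2 + ε) ∂μ := by
        have := integral_mono (integrable_const (δ ^ (2 + ε))) (integrable_of_continuous_of_compactSpace hc μ)
          fun x => Real.rpow_le_rpow hδ.le (hδw x) (by linarith)
        rwa [integral_const, probReal_univ, one_smul] at this
      exact lt_of_lt_of_le (Real.rpow_pos_of_pos hδ _) h1
    have hA : (∫ x, w x ^ (2 + ε) ∂μ) ≤ N * Real.exp (ε * Lg / 2) := by
      have hc := hHC f hf hfc hpos hn
      have e1 : 1 + Real.exp (4 * ρ * hn) = 2 + ε := by rw [hε]; ring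
      rw [e1] at hc
      have e2 : ∫ x, F x ^ (2 : ℝ) ∂μ = N := by
        rw [hN]; exact integral_congr_ae (Eventually.of_forall fun x => by simp only [Real.rpow_two])
      have hc' : (∫ x, w x ^ (2 + ε) ∂μ) ^ (1 / (2 + ε)) ≤ N ^ (1 / (2 : ℝ)) := by rw [← e2]; exact hc
      have hq0 : 0 < 2 + ε := by linarith
      have hlog := Real.log_le_log (Real.rpow_pos_of_pos hA0 _) hc'
      rw [Real.log_rpow hA0, Real.log_rpow hNpos] at hlog
      have h2 : Real.log (∫ x, w x ^ (2 + ε) ∂μ) ≤ Lg + ε * Lg / 2 := by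
        rw [hLg]
        have := mul_le_mul_of_nonneg_left hlog hq0.le
        have e3 : (2 + ε) * (1 / (2 + ε) * Real.log (∫ x, w x ^ (2 + ε) ∂μ)) = Real.log (∫ x, w x ^ (2 + ε) ∂μ) := by
          field_simp
        rw [e3] at this
        have e4 : (2 + ε) * (1 / 2 * Real.log N) = Real.log N + ε * Real.log N / 2 := by ring
        linarith
      calc (∫ x, w x ^ (2 + ε) ∂μ) = Real.exp (Real.log (∫ x, w x ^ (2 + ε) ∂μ)) := (Real.exp_log hA0).symm
        _ ≤ Real.exp (Lg + ε * Lg / 2) := Real.exp_le_exp.2 h2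
        _ = N * Real.exp (ε * Lg / 2) := by rw [Real.exp_add, hLg, Real.exp_log hNpos]
    -- the lower exponent bound and `∫ w² ≤ B²`
    have hΛw : ∀ x, |Real.log (w x)| ≤ Λ := fun x => hΛI (w x) (hδw x) (hwB x)
    have hlow0 := LqFlow.integral_rpow_add_ge μ hwc hwpos (q := 2) hΛw hε0 hεΛ
    have hw2 : Continuous fun x => w x ^ (2 : ℝ) := hwc.rpow_const fun x => Or.inl (hwpos x).ne'
    have hNwB : ∫ x, w x ^ (2 : ℝ) ∂μ ≤ B₂ := by
      have := integral_mono (integrable_of_continuous_of_compactSpace hw2 μ) (integrable_const B₂)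
        fun x => Real.rpow_le_rpow (hwpos x).le (hwB x) (by norm_num)
      rwa [integral_const, probReal_univ, one_smul] at this
    have hlow : (∫ x, w x ^ (2 : ℝ) ∂μ) + ε * (∫ x, w x ^ (2 : ℝ) * Real.log (w x) ∂μ) - (ε * Λ) ^ 2 * B₂ ≤
        ∫ x, w x ^ (2 + ε) ∂μ := by
      have h3 := mul_le_mul_of_nonneg_left hNwB (sq_nonneg (ε * Λ))
      linarith only [hlow0, h3]
    -- `∫ w² = ∫ F κ_{2h} F = N − τ·Φ(τ)`
    have hNw : ∫ x, w x ^ (2 : ℝ) ∂μ = N - 2 * (hn : ℝ) * Φ τ := by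
      have e1 : ∫ x, w x ^ (2 : ℝ) ∂μ = ∫ x, w x * w x ∂μ :=
        integral_congr_ae (Eventually.of_forall fun x => by simp only [Real.rpow_two, sq])
      have e2 : ∫ x, w x * w x ∂μ = ∫ x, F x * (∫ y, F y ∂(κ (hn + hn) x)) ∂μ :=
        integral_transition_mul_transition_eq L β' κ hreal hn hn hFc
      have e3 : N = ∫ x, F x * F x ∂μ := by
        rw [hN]; exact integral_congr_ae (Eventually.of_forall fun x => by simp only [sq])
      have e4 : τ * Φ τ = (∫ x, F x * F x ∂μ) - ∫ x, F x * (∫ y, F y ∂(κ τ.toNNReal x)) ∂μ := by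
        simp only [hΦ]; rw [← mul_assoc, mul_inv_cancel₀ hτ.ne', one_mul]
      rw [e1, e2, e3, ← hτnn]
      have e5 : 2 * (hn : ℝ) = τ := by rw [hhR]; ring
      rw [e5]
      linarith
    -- the Lipschitz comparison
    have hLip0 := LqFlow.abs_integral_rpow_mul_log_sub_le μ hwc hFc (q := 2) hδ hδw hwB hδF hFB hM₁' hD
    rw [probReal_univ, mul_one] at hLip0
    have hLip : |(∫ x, w x ^ (2 : ℝ) * Real.log (w x) ∂μ) - X| ≤ M₁ * C * hn := by
      rw [hX]; simpa [mul_assoc] using hLip0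
    -- assemble
    have hres := LqFlow.gross_converse_step (N := N) (A := ∫ x, w x ^ (2 + ε) ∂μ) (Nw := ∫ x, w x ^ (2 : ℝ) ∂μ) (X := X)
      (Xw := ∫ x, w x ^ (2 : ℝ) * Real.log (w x) ∂μ) (Ent := Ent) (L := Lg) (ε := ε) (h := hn) (ρ := ρ) (Φ := Φ τ)
      (M₁C := M₁ * C) (Λ := Λ) (B₂ := B₂) (E₁ := E₁)
      hNpos hhpos hρ hEnt0 (mul_nonneg hM₁0 hC0) hB₂0 hEnt2 hA hlow hNw hLip hεlo hεhi hεL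
    rw [hR, hhR] at *
    exact hres
  -- the limit `τ ↓ 0`
  have hlim : Tendsto (fun τ => Φ τ + R * (τ / 2)) (𝓝[>] 0) (𝓝 (-∫ x, F x * gen x ∂μ)) := by
    have h2 : Tendsto (fun τ : ℝ => R * (τ / 2)) (𝓝[>] 0) (𝓝 0) := by
      have hc : Continuous fun τ : ℝ => R * (τ / 2) := by fun_prop
      have := hc.tendsto 0
      simp only [zero_div, mul_zero] at this
      exact this.mono_left nhdsWithin_le_nhds
    have := hlimΦ.add h2
    rwa [add_zero] at this
  have hev : ∀ᶠ τ in 𝓝[>] (0 : ℝ), ρ * Ent ≤ Φ τ + R * (τ / 2) := by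
    filter_upwards [Ioo_mem_nhdsGT hτ₀pos] with τ hτ
    exact hstep τ hτ.1 hτ.2
  have hfinal := ge_of_tendsto hlim hev
  rw [hEnt, hLg, hN] at hfinal
  exact hfinal


end Summit.QuantumFields.YangMills.Theorems.ColdStartUniversality

end
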